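import Mathlib
import Summits.ValiantsHypothesis.ValiantsHypothesis.Theorems.RigidityForcesSymmetryRankRigidMinimalReprStubLevelBound
import Summits.ValiantsHypothesis.ValiantsHypothesis.Theorems.RigidityForcesSymmetryRankRigidMinimalReprPermPatternThree
import Summits.ValiantsHypothesis.ValiantsHypothesis.Theorems.RigidityForcesSymmetryRankRigidMinimalReprTripleBlocks

/-!
# Level count with THREE tied columns (crux `RankRigidMinimalRepr`, stmt-ValiantsHypothesis-18034) — part 2: the count

Route `ValiantsHypothesis/RigidityForcesSymmetry`, crux `RankRigidMinimalRepr` (stmt-ValiantsHypothesis-18034).  THEOREM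
(`levelBound_threeTied`, shape of the registered stub `stub_levelBound` with the tie `k = 1` replaced by `k = 2`):

  `∀ m ≥ 3, ∀ s w, 1 ≤ s → s + 1 ≤ m → TiedLevelDecomposable m 2 s w → m.choose s ≤ w`

— with the THREE columns `0, 1, 2` tied, every level-`s` typed decomposition `perm_m = Σ_{t<w} P_t Q_t` still needs
`C(m, s)` products (served-counting alone gives `C(m,s)/3`: a type with `ct ∈ {1, 2}` serves `3 · s!(m-s)!` permutations).

**Proof (block double count, one rung above `…StubLevelBound.lean`).**  For `σ` with `p, q, r = σ⁻¹ 0, σ⁻¹ 1, σ⁻¹ 2` the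
`27` graph monomials of `σ[p ↦ a, q ↦ b, r ↦ e]` (`a, b, e` tied) form the block of `σ`; on it the permanent is the
PERMUTATION PATTERN (`coeff_tau₃_perPoly`).  Node `t` TOUCHES `σ` if its block is non-zero; WEIGHT `1` for a split type
(`ct t ∈ {1, 2}`), `3` for an exact type.
* DEMAND (`three_le_sum_score₃`): every `σ` collects `≥ 3`: a touching split node contributes a SLICE (part 1,
  `block_isSlice₃`), and the permutation pattern is not a sum of two slices (`permPattern_three_not_two_slices`,
  `…PermPatternThree.lean` — slice rank of `P_3` is `3`); so an exact node touches, or at least three split nodes do.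
* SUPPLY (`sum_score₃_le`): a node collects `≤ 3 · s!(n+3-s)!`: a touched `σ` maps `I_t` onto `C_t ∪ E`, `|E| = ct t`,
  `E ⊆ {0,1,2}` — three candidates of weight `1` or one of weight `3` — each hit by `≤ s!(n+3-s)!` permutations
  (`card_perm_map_eq_le`).
* COUNT (`choose_le_of_typed_decomposition₃`): `3 · (n+3)! ≤ 3 · w · s!(n+3-s)!`.

LADDER REMARK.  With `k + 1` tied columns the same count reduces to the finite statement W(k+1): «the permutation tensor
`P_{k+1}` has no expression as a sum of split-rank-one terms of total cost `< 1` (cost `1/C(k+1, |S|)` for a split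
`S | Sᶜ`)», tight by Laplace expansion; W(2) is `…StubLevelBound.lean`, W(3) is `…PermPatternThree.lean`, W(4) is open
(numerical search: kit jobs recorded on the crux item).  CAVEAT: W(d) for ALL d would give the level counts for every tie, i.e. (with the
dictionary) Grenet-optimality `2^m - 1` for representations equivariant under the LEFT torus alone — the rung `TorusRung`
of the `DetqpThesis` ladder / unordered set-multilinear ABP lower bounds for the permanent, an OPEN problem (Arvind–Raja
2016, Rem. 1) — so the finite statements W(d) must get genuinely harder with `d`; only `d ≤ 3` is settled here.

HONEST FRAMING: an UNREGISTERED sequel (`--supports` helper) of the registered stub `stub_levelBound`; the corresponding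
rung `TiedTorusBound 2` would also need the dictionary stub `stub_levelDecomp` at `k = 2`; nothing here bears on
`VP ≠ VNP`.  The count is route mathematics (nearest literature: Nisan 1991; Landsberg–Ressayre 2017 §6; slice rank).
-/

set_option autoImplicit false

-- the mandated summit-side namespace repeats a component by design (single-problem summit)
set_option linter.dupNamespace false

open MvPolynomial Finset
open Literature.Computability.AlgebraicComplexity
open Summit.ValiantsHypothesis.ValiantsHypothesis.Theorems.RigidityForcesSymmetryPairTiedTorusBound

namespace Summit.ValiantsHypothesis.ValiantsHypothesis.Theorems.RigidityForcesSymmetryRankRigidMinimalRepr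

noncomputable section

open scoped Classical

variable {n : ℕ}

/-! ### §3 Supply: a node scores at most `3 · s! (n+3-s)!` -/

variable {w s : ℕ} (I : Fin w → Finset (Fin (n + 3))) (c c' : Fin w → Fin (n + 3) → ℕ) (ct ct' : Fin w → ℕ)
  (P Q : Fin w → MvPolynomial (Fin (n + 3) × Fin (n + 3)) ℂ)

/-- **Supply.**  A node `t` of a level-`s` typed decomposition with three tied columns scores at most
`3 · s! · (n+3-s)!` over all permutations (score = `1` if it touches `σ` and is of split type `ct t ∈ {1, 2}`, `3` if it
touches and is of exact type, `0` otherwise): a touched `σ` maps `I_t` onto `C_t ∪ E` with `E ⊆ {0,1,2}` of size `ct t`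
— three candidates for a split type, one for an exact type — each attained by `≤ s!(n+3-s)!` permutations. -/
theorem sum_score₃_le {t : Fin w} (hcard : (I t).card = s)
    (hP : IsTiedTyped (n + 3) 2 (I t) (c t) (ct t) (P t))
    (hQ : IsTiedTyped (n + 3) 2 (I t)ᶜ (c' t) (ct' t) (Q t)) :
    (∑ σ : Equiv.Perm (Fin (n + 3)),
      if (∃ a₁ a₂ a₃ : Fin (n + 3), a₁.val ≤ 2 ∧ a₂.val ≤ 2 ∧ a₃.val ≤ 2 ∧
          coeff (graphMonomial (tau₃ σ a₁ a₂ a₃)) (P t * Q t) ≠ 0)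
      then (if ct t = 1 ∨ ct t = 2 then 1 else 3) else 0) ≤ 3 * (s.factorial * (n + 3 - s).factorial) := by
  set cand : Finset (Finset (Fin (n + 3))) := ((Finset.univ : Finset (Bool × Bool × Bool)).filter
      (fun e => (if e.1 then 1 else 0) + (if e.2.1 then 1 else 0) + (if e.2.2 then 1 else 0) = ct t)).image
    (fun e => (Finset.univ.filter fun j : Fin (n + 3) => 2 < j.val ∧ c t j = 1) ∪
      ((if e.1 then {0} else ∅) ∪ ((if e.2.1 then {1} else ∅) ∪ (if e.2.2 then {2} else ∅)))) with hcand
  -- (1) a touched permutation maps `I t` onto a candidate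
  have hmem : ∀ σ : Equiv.Perm (Fin (n + 3)),
      (∃ a₁ a₂ a₃ : Fin (n + 3), a₁.val ≤ 2 ∧ a₂.val ≤ 2 ∧ a₃.val ≤ 2 ∧
          coeff (graphMonomial (tau₃ σ a₁ a₂ a₃)) (P t * Q t) ≠ 0) →
      (I t).map σ.toEmbedding ∈ cand := by
    rintro σ ⟨a₁, a₂, a₃, h₁, h₂, h₃, hne⟩
    rw [coeff_graphMonomial_mul_of_isTiedTyped hP hQ] at hne
    have hsupp : graphMonomialOn (I t) (tau₃ σ a₁ a₂ a₃) ∈ (P t).support :=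
      mem_support_iff.2 (left_ne_zero_of_mul hne)
    rw [hcand, Finset.mem_image]
    refine ⟨(decide (σ.symm 0 ∈ I t), decide (σ.symm 1 ∈ I t), decide (σ.symm 2 ∈ I t)), ?_, ?_⟩
    · rw [Finset.mem_filter]
      refine ⟨Finset.mem_univ _, ?_⟩
      rw [ct_eq_of_mem_support₃ hP σ h₁ h₂ h₃ hsupp]
      by_cases hp : σ.symm 0 ∈ I t <;> by_cases hq : σ.symm 1 ∈ I t <;> by_cases hr : σ.symm 2 ∈ I t <;>
        simp [hp, hq, hr]
    · have d01 : (0 : Fin (n + 3)) ≠ 1 := by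
        intro h; have := congrArg Fin.val h; rw [Fin.val_zero, Fin.val_one] at this; omega
      have d02 : (0 : Fin (n + 3)) ≠ 2 := by
        intro h; have := congrArg Fin.val h; rw [Fin.val_zero, Fin.val_two] at this; omega
      have d12 : (1 : Fin (n + 3)) ≠ 2 := by
        intro h; have := congrArg Fin.val h; rw [Fin.val_one, Fin.val_two] at this; omega
      ext j
      rw [Finset.mem_map_equiv, Finset.mem_union, Finset.mem_union, Finset.mem_union, Finset.mem_filter]
      by_cases hj : 2 < j.val
      · have hj0 : j ≠ 0 := fun h => by rw [h, Fin.val_zero] at hj; omega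
        have hj1 : j ≠ 1 := fun h => by rw [h, Fin.val_one] at hj; omega
        have hj2 : j ≠ 2 := fun h => by rw [h, Fin.val_two] at hj; omega
        rw [symm_mem_iff_of_mem_support₃ hP σ h₁ h₂ h₃ hsupp hj]
        by_cases hp : σ.symm 0 ∈ I t <;> by_cases hq : σ.symm 1 ∈ I t <;> by_cases hr : σ.symm 2 ∈ I t <;>
          simp [hp, hq, hr, hj, hj0, hj1, hj2]
      · have hj' : j = 0 ∨ j = 1 ∨ j = 2 := by
          rw [Fin.ext_iff, Fin.ext_iff, Fin.ext_iff, Fin.val_zero, Fin.val_one, Fin.val_two]; omega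
        rcases hj' with rfl | rfl | rfl
        · by_cases hp : σ.symm 0 ∈ I t <;> by_cases hq : σ.symm 1 ∈ I t <;>
            by_cases hr : σ.symm 2 ∈ I t <;> simp [hp, hq, hr, d01, d02]
        · by_cases hp : σ.symm 0 ∈ I t <;> by_cases hq : σ.symm 1 ∈ I t <;>
            by_cases hr : σ.symm 2 ∈ I t <;> simp [hp, hq, hr, d01.symm, d12]
        · have hmod : 2 % (n + 3) = 2 := Nat.mod_eq_of_lt (by omega)
          by_cases hp : σ.symm 0 ∈ I t <;> by_cases hq : σ.symm 1 ∈ I t <;>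
            by_cases hr : σ.symm 2 ∈ I t <;> simp [hp, hq, hr, d02.symm, d12.symm, hmod]
  -- (2) hence at most `|cand| · s!(n+3-s)!` permutations are touched
  have hT : (Finset.univ.filter fun σ : Equiv.Perm (Fin (n + 3)) =>
        ∃ a₁ a₂ a₃ : Fin (n + 3), a₁.val ≤ 2 ∧ a₂.val ≤ 2 ∧ a₃.val ≤ 2 ∧
          coeff (graphMonomial (tau₃ σ a₁ a₂ a₃)) (P t * Q t) ≠ 0).card
      ≤ cand.card * (s.factorial * (n + 3 - s).factorial) := by
    calc (Finset.univ.filter fun σ : Equiv.Perm (Fin (n + 3)) =>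
          ∃ a₁ a₂ a₃ : Fin (n + 3), a₁.val ≤ 2 ∧ a₂.val ≤ 2 ∧ a₃.val ≤ 2 ∧
            coeff (graphMonomial (tau₃ σ a₁ a₂ a₃)) (P t * Q t) ≠ 0).card
        ≤ (cand.biUnion fun J =>
            Finset.univ.filter fun σ : Equiv.Perm (Fin (n + 3)) => (I t).map σ.toEmbedding = J).card := by
          refine Finset.card_le_card fun σ hσ => ?_
          rw [Finset.mem_filter] at hσ
          rw [Finset.mem_biUnion]
          exact ⟨_, hmem σ hσ.2, Finset.mem_filter.2 ⟨Finset.mem_univ _, rfl⟩⟩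
      _ ≤ ∑ J ∈ cand,
            (Finset.univ.filter fun σ : Equiv.Perm (Fin (n + 3)) => (I t).map σ.toEmbedding = J).card :=
          Finset.card_biUnion_le
      _ ≤ ∑ _J ∈ cand, s.factorial * (n + 3 - s).factorial :=
          Finset.sum_le_sum fun J _ => by
            have := card_perm_map_eq_le (I t) J
            rwa [hcard] at this
      _ = cand.card * (s.factorial * (n + 3 - s).factorial) := by
          rw [Finset.sum_const, smul_eq_mul]
  -- (3) weight · |cand| ≤ 3
  have hwc : (if ct t = 1 ∨ ct t = 2 then 1 else 3) * cand.card ≤ 3 := by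
    have hle : cand.card ≤ ((Finset.univ : Finset (Bool × Bool × Bool)).filter (fun e =>
        (if e.1 then 1 else 0) + (if e.2.1 then 1 else 0) + (if e.2.2 then 1 else 0) = ct t)).card :=
      Finset.card_image_le
    by_cases h12 : ct t = 1 ∨ ct t = 2
    · rw [if_pos h12, one_mul]
      refine hle.trans ?_
      rcases h12 with h | h
      · rw [h]; exact card_tiedPatterns₃_one
      · rw [h]; exact card_tiedPatterns₃_two
    · rw [if_neg h12]
      push Not at h12
      have := hle.trans (card_tiedPatterns₃_le_one (ct t) h12.1 h12.2)
      omega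
  -- (4) the sum is `weight · #touched`
  rw [Finset.sum_ite, Finset.sum_const_zero, add_zero, Finset.sum_const, smul_eq_mul, mul_comm]
  calc (if ct t = 1 ∨ ct t = 2 then 1 else 3) * (Finset.univ.filter fun σ : Equiv.Perm (Fin (n + 3)) =>
          ∃ a₁ a₂ a₃ : Fin (n + 3), a₁.val ≤ 2 ∧ a₂.val ≤ 2 ∧ a₃.val ≤ 2 ∧
            coeff (graphMonomial (tau₃ σ a₁ a₂ a₃)) (P t * Q t) ≠ 0).card
      ≤ (if ct t = 1 ∨ ct t = 2 then 1 else 3) * (cand.card * (s.factorial * (n + 3 - s).factorial)) :=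
        Nat.mul_le_mul_left _ hT
    _ = ((if ct t = 1 ∨ ct t = 2 then 1 else 3) * cand.card) * (s.factorial * (n + 3 - s).factorial) := by ring
    _ ≤ 3 * (s.factorial * (n + 3 - s).factorial) := Nat.mul_le_mul_right _ hwc

/-! ### §4 Demand: every permutation is scored at least `3` -/

/-- **Demand.**  In a level-`s` typed decomposition `perm = Σ_t P_t Q_t` with three tied columns every permutation `σ`
has total score `≥ 3`: on its `3 × 3 × 3` block the permanent is the permutation pattern (`coeff_tau₃_perPoly`), which is
not a sum of two slices (`permPattern_three_not_two_slices`), while every touching node of split type contributes a slice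
(`block_isSlice₃`, `ct_eq_of_mem_support₃`); so either a node of exact type (weight `3`) touches `σ`, or at least three
nodes do. -/
theorem three_le_sum_score₃ (hP : ∀ t, IsTiedTyped (n + 3) 2 (I t) (c t) (ct t) (P t))
    (hQ : ∀ t, IsTiedTyped (n + 3) 2 (I t)ᶜ (c' t) (ct' t) (Q t))
    (hperm : perPoly (Fin (n + 3)) ℂ = ∑ t, P t * Q t) (σ : Equiv.Perm (Fin (n + 3))) :
    3 ≤ ∑ t : Fin w,
      if (∃ a₁ a₂ a₃ : Fin (n + 3), a₁.val ≤ 2 ∧ a₂.val ≤ 2 ∧ a₃.val ≤ 2 ∧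
          coeff (graphMonomial (tau₃ σ a₁ a₂ a₃)) (P t * Q t) ≠ 0)
      then (if ct t = 1 ∨ ct t = 2 then 1 else 3) else 0 := by
  by_contra hlt
  rw [not_le] at hlt
  set S := Finset.univ.filter fun t : Fin w =>
    ∃ a₁ a₂ a₃ : Fin (n + 3), a₁.val ≤ 2 ∧ a₂.val ≤ 2 ∧ a₃.val ≤ 2 ∧
      coeff (graphMonomial (tau₃ σ a₁ a₂ a₃)) (P t * Q t) ≠ 0 with hS
  -- the permanent's block is the sum of the blocks of the touching nodes
  have hJ : ∀ a₁ a₂ a₃ : Fin (n + 3), a₁.val ≤ 2 → a₂.val ≤ 2 → a₃.val ≤ 2 →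
      coeff (graphMonomial (tau₃ σ a₁ a₂ a₃)) (perPoly (Fin (n + 3)) ℂ) =
        ∑ t ∈ S, coeff (graphMonomial (tau₃ σ a₁ a₂ a₃)) (P t * Q t) := by
    intro a₁ a₂ a₃ h₁ h₂ h₃
    rw [hperm, coeff_sum]
    refine (Finset.sum_subset (Finset.filter_subset _ _) fun t _ ht => ?_).symm
    by_contra hne
    exact ht (Finset.mem_filter.2 ⟨Finset.mem_univ _, a₁, a₂, a₃, h₁, h₂, h₃, hne⟩)
  -- the total score bounds the number of touching nodes and forces them to be of split type
  have hscore : (∑ t : Fin w,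
      if (∃ a₁ a₂ a₃ : Fin (n + 3), a₁.val ≤ 2 ∧ a₂.val ≤ 2 ∧ a₃.val ≤ 2 ∧
          coeff (graphMonomial (tau₃ σ a₁ a₂ a₃)) (P t * Q t) ≠ 0)
      then (if ct t = 1 ∨ ct t = 2 then 1 else 3) else 0) = ∑ t ∈ S, (if ct t = 1 ∨ ct t = 2 then 1 else 3) := by
    rw [Finset.sum_ite, Finset.sum_const_zero, add_zero]
  have hS2 : S.card ≤ 2 := by
    have : S.card ≤ ∑ t ∈ S, (if ct t = 1 ∨ ct t = 2 then 1 else 3) := by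
      rw [Finset.card_eq_sum_ones]
      exact Finset.sum_le_sum fun t _ => by split_ifs <;> omega
    omega
  have hct : ∀ t ∈ S, ct t = 1 ∨ ct t = 2 := by
    intro t ht
    by_contra h
    have : (if ct t = 1 ∨ ct t = 2 then 1 else 3) ≤ ∑ t ∈ S, (if ct t = 1 ∨ ct t = 2 then 1 else 3) :=
      Finset.single_le_sum (f := fun t => if ct t = 1 ∨ ct t = 2 then 1 else 3) (fun _ _ => Nat.zero_le _) ht
    rw [if_neg h] at this
    omega
  -- every touching node contributes a slice
  have hslice : ∀ t ∈ S, ∃ i : Fin 3, ∃ φ : Fin (n + 3) → ℂ, ∃ Ψ : Fin (n + 3) → Fin (n + 3) → ℂ,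
      ∀ a b e : Fin (n + 3), coeff (graphMonomial (tau₃ σ a b e)) (P t * Q t) =
        (if i = 0 then φ a * Ψ b e else if i = 1 then φ b * Ψ a e else φ e * Ψ a b) := by
    intro t ht
    obtain ⟨a₁, a₂, a₃, h₁, h₂, h₃, hne⟩ := (Finset.mem_filter.1 ht).2
    rw [coeff_graphMonomial_mul_of_isTiedTyped (hP t) (hQ t)] at hne
    have hsupp : graphMonomialOn (I t) (tau₃ σ a₁ a₂ a₃) ∈ (P t).support :=
      mem_support_iff.2 (left_ne_zero_of_mul hne)
    have hct₀ := ct_eq_of_mem_support₃ (hP t) σ h₁ h₂ h₃ hsupp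
    refine block_isSlice₃ (hP t) (hQ t) σ ?_ ?_
    · rintro ⟨hp, hq, hr⟩
      rw [if_pos hp, if_pos hq, if_pos hr] at hct₀
      rcases hct t ht with h | h <;> omega
    · rintro ⟨hp, hq, hr⟩
      rw [if_neg hp, if_neg hq, if_neg hr] at hct₀
      rcases hct t ht with h | h <;> omega
  -- the data of the pattern lemma: the three tied columns and the pattern of the permanent
  have d01 : (0 : Fin (n + 3)) ≠ 1 := by
    intro h; have := congrArg Fin.val h; rw [Fin.val_zero, Fin.val_one] at this; omega
  have d02 : (0 : Fin (n + 3)) ≠ 2 := by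
    intro h; have := congrArg Fin.val h; rw [Fin.val_zero, Fin.val_two] at this; omega
  have d12 : (1 : Fin (n + 3)) ≠ 2 := by
    intro h; have := congrArg Fin.val h; rw [Fin.val_one, Fin.val_two] at this; omega
  have tied : ∀ a ∈ ({0, 1, 2} : Finset (Fin (n + 3))), a.val ≤ 2 := by
    intro a ha
    simp only [Finset.mem_insert, Finset.mem_singleton] at ha
    rcases ha with rfl | rfl | rfl
    · simp
    · simp
    · rw [Fin.val_two]
  have hpat : ∀ a ∈ ({0, 1, 2} : Finset (Fin (n + 3))), ∀ b ∈ ({0, 1, 2} : Finset (Fin (n + 3))),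
      ∀ e ∈ ({0, 1, 2} : Finset (Fin (n + 3))),
      coeff (graphMonomial (tau₃ σ a b e)) (perPoly (Fin (n + 3)) ℂ) = if a ≠ b ∧ a ≠ e ∧ b ≠ e then 1 else 0 :=
    fun a ha b hb e he => coeff_tau₃_perPoly σ (tied a ha) (tied b hb) (tied e he)
  -- `S` has `0`, `1` or `2` elements: in each case the pattern would be a sum of at most two slices
  have hS012 : S.card = 0 ∨ S.card = 1 ∨ S.card = 2 := by omega
  rcases hS012 with h0 | h1 | h2
  · rw [Finset.card_eq_zero] at h0
    have := hJ 0 1 2 (by simp) (by simp) (by rw [Fin.val_two])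
    rw [h0, Finset.sum_empty, coeff_tau₃_perPoly σ (by simp) (by simp) (by rw [Fin.val_two]),
      if_pos ⟨d01, d02, d12⟩] at this
    exact one_ne_zero this
  · obtain ⟨t₀, hSt⟩ := Finset.card_eq_one.1 h1
    obtain ⟨i, φ, Ψ, hB⟩ := hslice t₀ (by rw [hSt]; exact Finset.mem_singleton_self _)
    refine permPattern_three_not_two_slices d01 d02 d12 _ hpat i 0 _ (fun _ _ _ => 0) ⟨φ, Ψ, hB⟩
      ⟨fun _ => 0, fun _ _ => 0, fun _ _ _ => by simp⟩ fun a ha b hb e he => ?_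
    rw [hJ a b e (tied a ha) (tied b hb) (tied e he), hSt, Finset.sum_singleton, add_zero]
  · obtain ⟨t₁, t₂, hne, hSt⟩ := Finset.card_eq_two.1 h2
    obtain ⟨i, φ, Ψ, hB₁⟩ := hslice t₁ (by rw [hSt]; simp)
    obtain ⟨j, φ', Ψ', hB₂⟩ := hslice t₂ (by rw [hSt]; simp)
    refine permPattern_three_not_two_slices d01 d02 d12 _ hpat i j _ _ ⟨φ, Ψ, hB₁⟩ ⟨φ', Ψ', hB₂⟩
      fun a ha b hb e he => ?_
    rw [hJ a b e (tied a ha) (tied b hb) (tied e he), hSt, Finset.sum_pair hne]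

/-! ### §5 The count -/

/-- **The count**: a level-`s` typed decomposition of `perm_{n+3}` with three tied columns and `w` products has
`C(n+3, s) ≤ w` — demand `3 · (n+3)!` against supply `w · 3 · s!(n+3-s)!`. -/
theorem choose_le_of_typed_decomposition₃ (hs : s ≤ n + 3) (hcard : ∀ t, (I t).card = s)
    (hP : ∀ t, IsTiedTyped (n + 3) 2 (I t) (c t) (ct t) (P t))
    (hQ : ∀ t, IsTiedTyped (n + 3) 2 (I t)ᶜ (c' t) (ct' t) (Q t))
    (hperm : perPoly (Fin (n + 3)) ℂ = ∑ t, P t * Q t) : (n + 3).choose s ≤ w := by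
  have hF : 0 < s.factorial * (n + 3 - s).factorial :=
    Nat.mul_pos (Nat.factorial_pos _) (Nat.factorial_pos _)
  have h1 : 3 * (n + 3).factorial ≤ ∑ σ : Equiv.Perm (Fin (n + 3)), ∑ t : Fin w,
      if (∃ a₁ a₂ a₃ : Fin (n + 3), a₁.val ≤ 2 ∧ a₂.val ≤ 2 ∧ a₃.val ≤ 2 ∧
          coeff (graphMonomial (tau₃ σ a₁ a₂ a₃)) (P t * Q t) ≠ 0)
      then (if ct t = 1 ∨ ct t = 2 then 1 else 3) else 0 := by
    calc 3 * (n + 3).factorial = ∑ _σ : Equiv.Perm (Fin (n + 3)), 3 := by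
          rw [Finset.sum_const, smul_eq_mul, Finset.card_univ, Fintype.card_perm, Fintype.card_fin, mul_comm]
      _ ≤ _ := Finset.sum_le_sum fun σ _ => three_le_sum_score₃ I c c' ct ct' P Q hP hQ hperm σ
  have h2 : (∑ σ : Equiv.Perm (Fin (n + 3)), ∑ t : Fin w,
      if (∃ a₁ a₂ a₃ : Fin (n + 3), a₁.val ≤ 2 ∧ a₂.val ≤ 2 ∧ a₃.val ≤ 2 ∧
          coeff (graphMonomial (tau₃ σ a₁ a₂ a₃)) (P t * Q t) ≠ 0)
      then (if ct t = 1 ∨ ct t = 2 then 1 else 3) else 0) ≤ w * (3 * (s.factorial * (n + 3 - s).factorial)) := by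
    rw [Finset.sum_comm]
    calc _ ≤ ∑ _t : Fin w, 3 * (s.factorial * (n + 3 - s).factorial) :=
          Finset.sum_le_sum fun t _ => sum_score₃_le I c c' ct ct' P Q (hcard t) (hP t) (hQ t)
      _ = w * (3 * (s.factorial * (n + 3 - s).factorial)) := by
          rw [Finset.sum_const, smul_eq_mul, Finset.card_univ, Fintype.card_fin]
  have h3 : (n + 3).choose s * (s.factorial * (n + 3 - s).factorial) ≤
      w * (s.factorial * (n + 3 - s).factorial) := by
    have hfact : (n + 3).choose s * (s.factorial * (n + 3 - s).factorial) = (n + 3).factorial := by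
      rw [← mul_assoc]; exact Nat.choose_mul_factorial_mul_factorial hs
    rw [hfact]
    have := h1.trans h2
    rw [← mul_assoc, mul_comm w 3, mul_assoc] at this
    omega
  exact Nat.le_of_mul_le_mul_right h3 hF

/-! ### §6 The level count for three tied columns -/

/-- **Level count with THREE tied columns** (the `k = 2` member of the family behind the rungs `TiedTorusBound k` of
crux `RankRigidMinimalRepr`, shape of the registered stub `stub_levelBound` with `1` replaced by `2`): for `m ≥ 3` and
`1 ≤ s ≤ m - 1`, every level-`s` typed decomposition of `perm_m` for the tie `k = 2` (columns `0, 1, 2` tied) uses at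
least `C(m, s)` products.  Not a registered stub (the line `PairTiedTorusBound` registers `k = 1` only); landed as a
helper.  HONEST FRAMING: the «new mathematics» half of a prospective rung `TiedTorusBound 2`; the dictionary half
(`stub_levelDecomp` at `k = 2`) is open; no bearing on `VP ≠ VNP`. -/
theorem levelBound_threeTied :
    ∀ m : ℕ, 3 ≤ m → ∀ s w : ℕ, 1 ≤ s → s + 1 ≤ m → TiedLevelDecomposable m 2 s w → m.choose s ≤ w := by
  intro m hm s w _ hsm hdec
  obtain ⟨n, rfl⟩ : ∃ n, m = n + 3 := ⟨m - 3, by omega⟩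
  obtain ⟨I, c, c', ct, ct', P, Q, hcard, hP, hQ, -, -, hperm⟩ := hdec
  exact choose_le_of_typed_decomposition₃ I c c' ct ct' P Q (by omega) hcard hP hQ hperm

end

end Summit.ValiantsHypothesis.ValiantsHypothesis.Theorems.RigidityForcesSymmetryRankRigidMinimalRepr
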